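import Summits.CriticalPhenomena.CardyFormulaZ2.Theses.CardyMagicRigidity
import Literature.Probability.Percolation.CardyFormulaConformalInvariance
import Literature.Probability.Percolation.BoxCrossingUpperBound
import Literature.Probability.Percolation.ZdNearCriticalWindow
import Literature.Probability.Percolation.HalfSpacePinnedPairs
import Literature.Probability.Percolation.SharpnessDCTProofs
import Literature.Probability.RandomPlanarGeometry.ConformalRectangleProofs
import Summits.CriticalPhenomena.CardyFormulaZ2.Theorems.CardyMagicRigidityLoopsToCrossingsStubCyclicFlip
import Summits.CriticalPhenomena.CardyFormulaZ2.Theorems.CardyMagicRigidityLoopsToCrossingsStubDiscreteCrossingOfPathIn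
import Summits.CriticalPhenomena.CardyFormulaZ2.Theorems.CardyMagicRigidityLoopsToCrossingsStubCardyContinuity
import Summits.CriticalPhenomena.CardyFormulaZ2.Theorems.CardyMagicRigidityLoopsToCrossingsStubNotDiscreteCrossingOfDualPathIn
import Summits.CriticalPhenomena.CardyFormulaZ2.Theorems.CardyMagicRigidityLoopsToCrossingsStubZdPlateDuality
import Summits.CriticalPhenomena.CardyFormulaZ2.Theorems.CardyMagicRigidityLoopsToCrossingsStubComparisonGeometry
import Summits.CriticalPhenomena.CardyFormulaZ2.Theorems.CardyMagicRigidityLoopsToCrossingsStubPlusBlocking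
import Summits.CriticalPhenomena.CardyFormulaZ2.Theorems.CardyMagicRigidityLoopsToCrossingsStubTriPlateDuality
import Summits.CriticalPhenomena.CardyFormulaZ2.Theorems.CardyMagicRigidityLoopsToCrossingsStubTransferVerticalTtoZ
import Summits.CriticalPhenomena.CardyFormulaZ2.Theorems.CardyMagicRigidityLoopsToCrossingsStubZdLoopArc
import Summits.CriticalPhenomena.CardyFormulaZ2.Theorems.CardyMagicRigidityLoopsToCrossingsStubTriBlockedByCloseArc
import Summits.CriticalPhenomena.CardyFormulaZ2.Theorems.CardyMagicRigidityLoopsToCrossingsStubTransferTriToBond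
import Summits.CriticalPhenomena.CardyFormulaZ2.Theorems.CardyMagicRigidityLoopsToCrossingsStubComparisonRectangles
import Literature.Probability.Percolation.ZdPlatePolarisation
import Literature.Probability.Percolation.FullPlaneCNL
import Literature.Probability.Percolation.AnnulusCrossingBound
import Literature.Probability.Percolation.TriAnnulusCrossing
import Literature.Probability.Percolation.QuadCrossingSquareModel
import Literature.Probability.Percolation.PlateCrossingEvents

/-!
# Line `oracle-sandwich` — skeleton for crux `LoopsToCrossings` (stmt-CriticalPhenomena-4837)

Route `CardyMagicRigidity`, crux `LoopsToCrossings : X → ∀ R, bond R δ - tri R δ → 0` with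
`X = LoopLimitZ2EqT` (full-plane loop universality `ℤ² ~ 𝕋` in DKKMO's `d_CN`).

**Idea (card `oracle-sandwich`, merged by the r1 triage panel with `cardy-sandwich-rado-chart`
and `br-sandwich-diagonal`).** Smirnov's theorem on `𝕋` is proved in the tree for EVERY
conformal rectangle (`hasCrossingLimit_triDomainCrossingProb_holds`), so the subtrahend of the
crux is an oracle: it is enough to show `bond R δ → F(η_R)`. The wild boundary of `R` is handled
once and for all by the construction-free Bollobás–Riordan sandwich (Ch. 7, Claim 19 + remark
p. 195), whose `𝕋` version is proved in the tree (`mem_triCrossing_of_pathIn`,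
`not_mem_triCrossing_compl_of_pathIn`): an open lattice path of a longer–thinner comparison
domain poking out across `arc 0`, `arc 2` of `R` IS a G02 crossing of `R` (stub A, bond port),
and a dual-open (= primal-closed) path of a comparison domain poking out across `arc 1`, `arc 3`
EXCLUDES one (stub B, bond/dual port, Newman's cross-cut theorem).  The comparison domains are
conformal rectangles `Q`, `N` in *sandwich position* with ROOM `r` (stub D: they exist with Cardy
values as close as we please to `F(η_R)`, resp. `1 - F(η_R)` — collar rectangles of a re-marked
`R` + continuity of the cross-ratio, Radó/Carathéodory), so that the only cross-lattice input is
ONE-SIDED and has four-sided room: stub C, the load-bearing stub and the only place where `X` is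
used — a G02 crossing of `Q` on `δ𝕋` forces, up to probability `ε`, an open bond path of `δℤ²`
inside the `r`-fattening of `Q` from the `r`-fattening of `Q.arc 0` to that of `Q.arc 2`.
Bond self-duality at `p = 1/2` (`bondPercolation_half_real_preimage_dualConfig`, tree) turns the
dual-path probability of stub B into the open-path probability that stub C bounds from below.

Composition `LoopsToCrossings_of` (no `sorry`): lower bound
`bond R δ ≥ P[open plate path of Q] ≥ tri Q δ - ε → F(η_Q) - ε ≥ F(η_R) - 2ε`
(stub A ∘ stub C ∘ Smirnov(Q) ∘ stub D); upper bound
`bond R δ ≤ 1 - P[dual plate path of N] = 1 - P[open plate path of N] ≤ 1 - tri N δ + ε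
→ 1 - F(η_N) + ε ≤ F(η_R) + 2ε` (stub B ∘ duality ∘ stub C ∘ Smirnov(N) ∘ stub D); then
`bond R δ → F(η_R)` and `tri R δ → F(η_R)` give the crux.

Disproof.lean (gen 2) honoured: §2 (no `_false_without_X` exists; `X` enters at stub C only),
§4 `hits_not_isClose_robust` (every cross-lattice comparison here has room `r > 0`, fixed before
`δ → 0`), §6 `not_uniformCrossingUniversality` (everything is per rectangle), §5 template
(the four "sandwich estimates" of `sandwich_transfer` are replaced by the deterministic
inclusions A/B plus the oracle continuity D; no boundary arm estimate appears in this line).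
-/

noncomputable section

namespace Summit.CriticalPhenomena.CardyFormulaZ2.Cruxes.LoopsToCrossings.OracleSandwich

open Summit.CriticalPhenomena.CardyFormulaZ2.Theses.CardyMagicRigidity
open Literature.Probability.RandomPlanarGeometry hiding cardyFunction
open Literature.Probability.Percolation hiding cardyFunction
open Literature.Probability.LatticeModels
open Filter Topology Set MeasureTheory Metric

/-! ## The stubs: all LANDED as `Theorems/CardyMagicRigidityLoopsToCrossingsStub*.lean` (imported)

A `stub_discreteCrossing_of_pathIn` (p73826) · B `stub_not_discreteCrossing_of_dualPathIn` (p74395) ·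
C `stub_transfer_tri_to_bond` (from G1 `stub_zdPlateDuality` p75772, G2 `stub_triPlateDuality`,
B-plus `stub_plusBlocking` p78534, T1 `stub_transferVerticalTtoZ`, T2a `stub_zdLoopArc`,
T2b `stub_triBlockedByCloseArc`) · D1 `stub_cardyContinuity` (p74311) · D2 `stub_comparisonGeometry`
(p77019) · D3 `stub_cyclicFlip` (p73646).  History of the reshapes: `Lines/oracle-sandwich.lean`. -/

-- comparisonRectangles_of_stubs / stub_comparisonRectangles: LANDED — Theorems/CardyMagicRigidityLoopsToCrossingsStubComparisonRectangles.lean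

/-! ## Glue (proved): measurability, the two per-mesh inequalities, the composition -/

-- measurability of plate-path events: `measurableSet_openCrossing_site'` (Literature/…/ZdPlatePolarisation.lean)

/-- A restricted open connection of a lattice configuration is a `PathIn` of `openGraph ω ⊓ ℤ²`.
[folklore] -/
theorem pathIn_inf_of_mem_openConnIn {ω : BondConfig (Site 2)} (hω : ω ⊆ (zdGraph 2).edgeSet)
    {S : Set (Site 2)} {u v : Site 2} (h : ω ∈ openConnIn S u v) :
    PathIn (openGraph ω ⊓ zdGraph 2) S u v := by
  rw [openGraph_inf_eq, Set.inter_eq_left.2 hω]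
  exact DCT16.pathIn_of_mem_openConnIn h

/-- The physical dual position of a site is within `δ` of its mesh point, hence the half-diagonal
offset is absorbed by doubling the room. [folklore] -/
theorem dualScale_mem_cthickening {δ r : ℝ} (hδ : 0 < δ) (hδr : δ ≤ r / 2) {K : Set ℂ} {x : Site 2}
    (hx : meshPoint δ x ∈ cthickening (r / 2) K) : dualScale δ (Site.toComplex x) ∈ cthickening r K := by
  have hre : dualOffset.re = 1 / 2 := rfl
  have him : dualOffset.im = 1 / 2 := rfl
  have hoff : ‖dualOffset‖ ≤ 1 := by
    refine (Complex.norm_le_abs_re_add_abs_im _).trans ?_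
    rw [hre, him]; norm_num
  have hd : dist (dualScale δ (Site.toComplex x)) (meshPoint δ x) ≤ r / 2 := by
    rw [dualScale_toComplex, dist_eq_norm, add_sub_cancel_left, norm_mul, Complex.norm_real,
      Real.norm_of_nonneg hδ.le]
    calc δ * ‖dualOffset‖ ≤ δ * 1 := by gcongr
      _ ≤ r / 2 := by linarith
  have h1 := mem_cthickening_of_dist_le _ _ (r / 2) _ hx hd
  have h2 := cthickening_cthickening_subset (by linarith : (0 : ℝ) ≤ r / 2) (by linarith : (0 : ℝ) ≤ r / 2) K h1
  rwa [add_halves] at h2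

/-- **Lower per-mesh inequality**: with stub A's constants for `R` and a comparison rectangle in
lower sandwich position, the plate-path probability is at most `bond R δ`. [folklore] -/
theorem real_openCrossing_le_bond (R : ConformalRectangle) {δ₀ t₀ : ℝ}
    (hAfor : ∀ δ t : ℝ, 0 < δ → δ < δ₀ → 0 ≤ t → t ≤ t₀ →
        ∀ (ω : BondConfig (Site 2)) (S : Set (Site 2)) (u v : Site 2),
          (∀ x ∈ S, meshPoint δ x ∉ R.carrier →
            infDist (meshPoint δ x) (R.arc 0) ≤ t ∨ infDist (meshPoint δ x) (R.arc 2) ≤ t) →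
          (∀ x ∈ S, meshPoint δ x ∈ R.carrier →
            δ < infDist (meshPoint δ x) (R.arc 1) ∧ δ < infDist (meshPoint δ x) (R.arc 3)) →
          meshPoint δ u ∉ R.carrier → infDist (meshPoint δ u) (R.arc 0) ≤ t →
          meshPoint δ v ∉ R.carrier → infDist (meshPoint δ v) (R.arc 2) ≤ t →
          PathIn (openGraph ω ⊓ zdGraph 2) S u v →
          ω ∈ discreteCrossing R.carrier δ (R.arc 0) (R.arc 2))
    {Q : ConformalRectangle} {r m t δ : ℝ}
    (hL1 : ∀ z ∈ cthickening r Q.carrier, z ∉ R.carrier →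
      infDist z (R.arc 0) ≤ t ∨ infDist z (R.arc 2) ≤ t)
    (hL2 : ∀ z ∈ cthickening r Q.carrier, z ∈ R.carrier →
      m ≤ infDist z (R.arc 1) ∧ m ≤ infDist z (R.arc 3))
    (hL3 : ∀ z ∈ cthickening r (Q.arc 0), z ∉ R.carrier ∧ infDist z (R.arc 0) ≤ t)
    (hL4 : ∀ z ∈ cthickening r (Q.arc 2), z ∉ R.carrier ∧ infDist z (R.arc 2) ≤ t)
    (hδ : 0 < δ) (hδ₀ : δ < δ₀) (hδm : δ < m) (ht : 0 ≤ t) (htt₀ : t ≤ t₀) :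
    (bondPercolation (zdGraph 2) half).real
        (openCrossing {x : Site 2 | meshPoint δ x ∈ cthickening r Q.carrier}
          {x | meshPoint δ x ∈ cthickening r (Q.arc 0)}
          {x | meshPoint δ x ∈ cthickening r (Q.arc 2)}) ≤ bondDomainCrossingProb R δ := by
  rw [bondDomainCrossingProb_eq_measureReal]
  simp only [measureReal_def]
  refine ENNReal.toReal_mono (measure_ne_top _ _) (measure_mono_ae ?_)
  filter_upwards [ae_subset_edgeSet (zdGraph 2) half] with ω hω
  intro hoc
  obtain ⟨u, hu, v, hv, huv⟩ := mem_openCrossing_iff.1 hoc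
  have hp : PathIn (openGraph ω ⊓ zdGraph 2) {x : Site 2 | meshPoint δ x ∈ cthickening r Q.carrier} u v :=
    pathIn_inf_of_mem_openConnIn hω huv
  exact hAfor δ t hδ hδ₀ ht htt₀ ω _ u v (fun x hx hxR => hL1 _ hx hxR)
    (fun x hx hxR => ⟨hδm.trans_le (hL2 _ hx hxR).1, hδm.trans_le (hL2 _ hx hxR).2⟩)
    (hL3 _ hu).1 (hL3 _ hu).2 (hL4 _ hv).1 (hL4 _ hv).2 hp

/-- **Upper per-mesh inequality**: with stub B's constants for `R` (corner margin `m`) and a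
comparison rectangle in upper sandwich position with room `r`, `bond R δ` is at most one minus
the probability of an OPEN plate path of the `r/2`-fattening (bond self-duality at `1/2`).
[folklore] -/
theorem bond_le_one_sub_real_openCrossing (R : ConformalRectangle) {m δ₀ t₀ : ℝ}
    (hBfor : ∀ δ t : ℝ, 0 < δ → δ < δ₀ → 0 ≤ t → t ≤ t₀ →
        ∀ (ω : BondConfig (Site 2)) (S : Set (Site 2)) (u v : Site 2),
          (∀ x ∈ S, dualScale δ (Site.toComplex x) ∉ R.carrier →
            infDist (dualScale δ (Site.toComplex x)) (R.arc 1) ≤ t ∨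
              infDist (dualScale δ (Site.toComplex x)) (R.arc 3) ≤ t) →
          (∀ x ∈ S, dualScale δ (Site.toComplex x) ∈ R.carrier →
            3 * δ < infDist (dualScale δ (Site.toComplex x)) (R.arc 0) ∧
              3 * δ < infDist (dualScale δ (Site.toComplex x)) (R.arc 2)) →
          (∀ x ∈ S, dualScale δ (Site.toComplex x) ∈ R.carrier →
            ∀ j : Fin 4, m ≤ dist (dualScale δ (Site.toComplex x)) (R.pt j)) →
          dualScale δ (Site.toComplex u) ∉ R.carrier →
            infDist (dualScale δ (Site.toComplex u)) (R.arc 1) ≤ t →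
          dualScale δ (Site.toComplex v) ∉ R.carrier →
            infDist (dualScale δ (Site.toComplex v)) (R.arc 3) ≤ t →
          PathIn (openGraph (dualConfig ω) ⊓ zdGraph 2) S u v →
          ω ∉ discreteCrossing R.carrier δ (R.arc 0) (R.arc 2))
    {N : ConformalRectangle} {r t δ : ℝ}
    (hU1 : ∀ z ∈ cthickening r N.carrier, z ∉ R.carrier →
      infDist z (R.arc 1) ≤ t ∨ infDist z (R.arc 3) ≤ t)
    (hU2 : ∀ z ∈ cthickening r N.carrier, z ∈ R.carrier →
      m ≤ infDist z (R.arc 0) ∧ m ≤ infDist z (R.arc 2))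
    (hU3 : ∀ z ∈ cthickening r N.carrier, z ∈ R.carrier → ∀ j : Fin 4, m ≤ dist z (R.pt j))
    (hU4 : ∀ z ∈ cthickening r (N.arc 0), z ∉ R.carrier ∧ infDist z (R.arc 1) ≤ t)
    (hU5 : ∀ z ∈ cthickening r (N.arc 2), z ∉ R.carrier ∧ infDist z (R.arc 3) ≤ t)
    (hδ : 0 < δ) (hδ₀ : δ < δ₀) (h3δ : 3 * δ < m) (hδr : δ ≤ r / 2) (ht : 0 ≤ t) (htt₀ : t ≤ t₀) :
    bondDomainCrossingProb R δ ≤ 1 -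
      (bondPercolation (zdGraph 2) half).real
        (openCrossing {x : Site 2 | meshPoint δ x ∈ cthickening (r / 2) N.carrier}
          {x | meshPoint δ x ∈ cthickening (r / 2) (N.arc 0)}
          {x | meshPoint δ x ∈ cthickening (r / 2) (N.arc 2)}) := by
  set E : Set (BondConfig (Site 2)) :=
    openCrossing {x : Site 2 | meshPoint δ x ∈ cthickening (r / 2) N.carrier}
      {x | meshPoint δ x ∈ cthickening (r / 2) (N.arc 0)}
      {x | meshPoint δ x ∈ cthickening (r / 2) (N.arc 2)} with hE
  have hmeas : MeasurableSet E := measurableSet_openCrossing_site' _ _ _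
  have key : ∀ {K : Set ℂ} {x : Site 2}, meshPoint δ x ∈ cthickening (r / 2) K →
      dualScale δ (Site.toComplex x) ∈ cthickening r K := fun hx => dualScale_mem_cthickening hδ hδr hx
  have hsub : discreteCrossing R.carrier δ (R.arc 0) (R.arc 2) ⊆ (dualConfig ⁻¹' E)ᶜ := by
    intro ω hω hoc
    rw [Set.mem_preimage, hE] at hoc
    obtain ⟨u, hu, v, hv, huv⟩ := mem_openCrossing_iff.1 hoc
    have hp : PathIn (openGraph (dualConfig ω) ⊓ zdGraph 2)
        {x : Site 2 | meshPoint δ x ∈ cthickening (r / 2) N.carrier} u v :=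
      pathIn_inf_of_mem_openConnIn (dualConfig_subset_edgeSet ω) huv
    exact hBfor δ t hδ hδ₀ ht htt₀ ω _ u v (fun x hx hxR => hU1 _ (key hx) hxR)
      (fun x hx hxR => ⟨h3δ.trans_le (hU2 _ (key hx) hxR).1, h3δ.trans_le (hU2 _ (key hx) hxR).2⟩)
      (fun x hx hxR j => hU3 _ (key hx) hxR j)
      (hU4 _ (key hu)).1 (hU4 _ (key hu)).2 (hU5 _ (key hv)).1 (hU5 _ (key hv)).2 hp hω
  calc bondDomainCrossingProb R δ
        = (bondPercolation (zdGraph 2) half).real (discreteCrossing R.carrier δ (R.arc 0) (R.arc 2)) := rfl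
    _ ≤ (bondPercolation (zdGraph 2) half).real (dualConfig ⁻¹' E)ᶜ := measureReal_mono hsub
    _ = 1 - (bondPercolation (zdGraph 2) half).real (dualConfig ⁻¹' E) := by
          rw [measureReal_compl (measurable_dualConfig hmeas), probReal_univ]
    _ = 1 - (bondPercolation (zdGraph 2) half).real E := by
          rw [bondPercolation_half_real_preimage_dualConfig hmeas]

/-- **Composition, arrow form.** The four stub STATEMENTS imply the crux, unfolded
(`X → ∀ R, bond R δ - tri R δ → 0`); sorry-free. Smirnov's theorem on `𝕋`
(`hasCrossingLimit_triDomainCrossingProb_holds`) is the oracle for `R`, `Q` and `N`; uniformizing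
data exist (`MarkedDomain.exists_isUniformizing_holds`). [folklore] -/
theorem tendsto_sub_of_stubs :
    (∀ R : ConformalRectangle,
      ∃ δ₀ > 0, ∃ t₀ > 0, ∀ δ t : ℝ, 0 < δ → δ < δ₀ → 0 ≤ t → t ≤ t₀ →
        ∀ (ω : BondConfig (Site 2)) (S : Set (Site 2)) (u v : Site 2),
          (∀ x ∈ S, meshPoint δ x ∉ R.carrier →
            infDist (meshPoint δ x) (R.arc 0) ≤ t ∨ infDist (meshPoint δ x) (R.arc 2) ≤ t) →
          (∀ x ∈ S, meshPoint δ x ∈ R.carrier →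
            δ < infDist (meshPoint δ x) (R.arc 1) ∧ δ < infDist (meshPoint δ x) (R.arc 3)) →
          meshPoint δ u ∉ R.carrier → infDist (meshPoint δ u) (R.arc 0) ≤ t →
          meshPoint δ v ∉ R.carrier → infDist (meshPoint δ v) (R.arc 2) ≤ t →
          PathIn (openGraph ω ⊓ zdGraph 2) S u v →
          ω ∈ discreteCrossing R.carrier δ (R.arc 0) (R.arc 2)) →
    (∀ (R : ConformalRectangle) (ρ : ℝ), 0 < ρ →
      ∃ δ₀ > 0, ∃ t₀ > 0, ∀ δ t : ℝ, 0 < δ → δ < δ₀ → 0 ≤ t → t ≤ t₀ →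
        ∀ (ω : BondConfig (Site 2)) (S : Set (Site 2)) (u v : Site 2),
          (∀ x ∈ S, dualScale δ (Site.toComplex x) ∉ R.carrier →
            infDist (dualScale δ (Site.toComplex x)) (R.arc 1) ≤ t ∨
              infDist (dualScale δ (Site.toComplex x)) (R.arc 3) ≤ t) →
          (∀ x ∈ S, dualScale δ (Site.toComplex x) ∈ R.carrier →
            3 * δ < infDist (dualScale δ (Site.toComplex x)) (R.arc 0) ∧
              3 * δ < infDist (dualScale δ (Site.toComplex x)) (R.arc 2)) →
          (∀ x ∈ S, dualScale δ (Site.toComplex x) ∈ R.carrier →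
            ∀ j : Fin 4, ρ ≤ dist (dualScale δ (Site.toComplex x)) (R.pt j)) →
          dualScale δ (Site.toComplex u) ∉ R.carrier →
            infDist (dualScale δ (Site.toComplex u)) (R.arc 1) ≤ t →
          dualScale δ (Site.toComplex v) ∉ R.carrier →
            infDist (dualScale δ (Site.toComplex v)) (R.arc 3) ≤ t →
          PathIn (openGraph (dualConfig ω) ⊓ zdGraph 2) S u v →
          ω ∉ discreteCrossing R.carrier δ (R.arc 0) (R.arc 2)) →
    (LoopLimitZ2EqT →
      ∀ (Q : ConformalRectangle) (r : ℝ), 0 < r → ∀ ε : ℝ, 0 < ε →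
        ∀ᶠ δ : ℝ in 𝓝[>] 0,
          triDomainCrossingProb Q δ ≤
            (bondPercolation (zdGraph 2) half).real
              (openCrossing {x : Site 2 | meshPoint δ x ∈ cthickening r Q.carrier}
                {x | meshPoint δ x ∈ cthickening r (Q.arc 0)}
                {x | meshPoint δ x ∈ cthickening r (Q.arc 2)}) + ε) →
    (∀ (R : ConformalRectangle) (φ : ConformalEquiv UpperHalfPlane.upperHalfPlaneSet R.carrier)
      (x : Fin 4 → ℝ), R.IsUniformizing φ x → ∀ τ : ℝ, 0 < τ →
      ∃ m : ℝ, 0 < m ∧ ∀ t : ℝ, 0 < t →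
        (∃ (Q : ConformalRectangle) (ψ : ConformalEquiv UpperHalfPlane.upperHalfPlaneSet Q.carrier)
            (y : Fin 4 → ℝ) (r : ℝ), Q.IsUniformizing ψ y ∧ 0 < r ∧
            |Literature.Probability.RandomPlanarGeometry.cardyFunction (crossRatio y) - Literature.Probability.RandomPlanarGeometry.cardyFunction (crossRatio x)| ≤ τ ∧
            (∀ z ∈ cthickening r Q.carrier, z ∉ R.carrier →
              infDist z (R.arc 0) ≤ t ∨ infDist z (R.arc 2) ≤ t) ∧
            (∀ z ∈ cthickening r Q.carrier, z ∈ R.carrier →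
              m ≤ infDist z (R.arc 1) ∧ m ≤ infDist z (R.arc 3)) ∧
            (∀ z ∈ cthickening r (Q.arc 0), z ∉ R.carrier ∧ infDist z (R.arc 0) ≤ t) ∧
            (∀ z ∈ cthickening r (Q.arc 2), z ∉ R.carrier ∧ infDist z (R.arc 2) ≤ t)) ∧
        (∃ (N : ConformalRectangle) (ψ : ConformalEquiv UpperHalfPlane.upperHalfPlaneSet N.carrier)
            (y : Fin 4 → ℝ) (r : ℝ), N.IsUniformizing ψ y ∧ 0 < r ∧
            |Literature.Probability.RandomPlanarGeometry.cardyFunction (crossRatio y) - (1 - Literature.Probability.RandomPlanarGeometry.cardyFunction (crossRatio x))| ≤ τ ∧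
            (∀ z ∈ cthickening r N.carrier, z ∉ R.carrier →
              infDist z (R.arc 1) ≤ t ∨ infDist z (R.arc 3) ≤ t) ∧
            (∀ z ∈ cthickening r N.carrier, z ∈ R.carrier →
              m ≤ infDist z (R.arc 0) ∧ m ≤ infDist z (R.arc 2)) ∧
            (∀ z ∈ cthickening r N.carrier, z ∈ R.carrier → ∀ j : Fin 4, m ≤ dist z (R.pt j)) ∧
            (∀ z ∈ cthickening r (N.arc 0), z ∉ R.carrier ∧ infDist z (R.arc 1) ≤ t) ∧
            (∀ z ∈ cthickening r (N.arc 2), z ∉ R.carrier ∧ infDist z (R.arc 3) ≤ t))) →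
    LoopLimitZ2EqT → ∀ R : ConformalRectangle,
      Tendsto (fun δ : ℝ ↦ bondDomainCrossingProb R δ - triDomainCrossingProb R δ) (𝓝[>] 0) (𝓝 0) := by
  intro hA hB hC hD hX R
  obtain ⟨φ, x, hux⟩ := MarkedDomain.exists_isUniformizing_holds R
  have htri : Tendsto (triDomainCrossingProb R) (𝓝[>] 0)
      (𝓝 (Literature.Probability.RandomPlanarGeometry.cardyFunction (crossRatio x))) :=
    hasCrossingLimit_triDomainCrossingProb_holds R φ x hux
  set L : ℝ := Literature.Probability.RandomPlanarGeometry.cardyFunction (crossRatio x) with hL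
  -- lower bound: stub D (lower side) + stub A + stub C + Smirnov for `Q`
  have hlow : ∀ e : ℝ, 0 < e → ∀ᶠ δ : ℝ in 𝓝[>] 0, L - e < bondDomainCrossingProb R δ := by
    intro e he
    obtain ⟨m, hm, hDm⟩ := hD R φ x hux (e / 3) (by positivity)
    obtain ⟨δ₀, hδ₀, t₀, ht₀, hAfor⟩ := hA R
    obtain ⟨⟨Q, ψ, y, r, hψ, hr, hF, hL1, hL2, hL3, hL4⟩, -⟩ := hDm t₀ ht₀
    have hQ : Tendsto (triDomainCrossingProb Q) (𝓝[>] 0)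
        (𝓝 (Literature.Probability.RandomPlanarGeometry.cardyFunction (crossRatio y))) :=
      hasCrossingLimit_triDomainCrossingProb_holds Q ψ y hψ
    have hCQ := hC hX Q r hr (e / 3) (by positivity)
    have hev1 : ∀ᶠ δ : ℝ in 𝓝[>] 0,
        Literature.Probability.RandomPlanarGeometry.cardyFunction (crossRatio y) - e / 3 <
          triDomainCrossingProb Q δ :=
      hQ.eventually (lt_mem_nhds (by linarith))
    have hev2 : ∀ᶠ δ : ℝ in 𝓝[>] 0, δ ∈ Ioo 0 (min δ₀ m) := Ioo_mem_nhdsGT (lt_min hδ₀ hm)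
    filter_upwards [hCQ, hev1, hev2] with δ h1 h2 h3
    have hle := real_openCrossing_le_bond R hAfor hL1 hL2 hL3 hL4 h3.1
      (h3.2.trans_le (min_le_left _ _)) (h3.2.trans_le (min_le_right _ _)) ht₀.le le_rfl
    have hF' := (abs_sub_le_iff.1 hF).2
    linarith
  -- upper bound: stub D (upper side) + stub B + duality + stub C + Smirnov for `N`
  have hup : ∀ e : ℝ, 0 < e → ∀ᶠ δ : ℝ in 𝓝[>] 0, bondDomainCrossingProb R δ < L + e := by
    intro e he
    obtain ⟨m, hm, hDm⟩ := hD R φ x hux (e / 3) (by positivity)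
    obtain ⟨δ₀, hδ₀, t₀, ht₀, hBfor⟩ := hB R m hm
    obtain ⟨-, ⟨N, ψ, y, r, hψ, hr, hF, hU1, hU2, hU3, hU4, hU5⟩⟩ := hDm t₀ ht₀
    have hN : Tendsto (triDomainCrossingProb N) (𝓝[>] 0)
        (𝓝 (Literature.Probability.RandomPlanarGeometry.cardyFunction (crossRatio y))) :=
      hasCrossingLimit_triDomainCrossingProb_holds N ψ y hψ
    have hCN := hC hX N (r / 2) (by positivity) (e / 3) (by positivity)
    have hev1 : ∀ᶠ δ : ℝ in 𝓝[>] 0,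
        Literature.Probability.RandomPlanarGeometry.cardyFunction (crossRatio y) - e / 3 <
          triDomainCrossingProb N δ :=
      hN.eventually (lt_mem_nhds (by linarith))
    have hev2 : ∀ᶠ δ : ℝ in 𝓝[>] 0, δ ∈ Ioo 0 (min δ₀ (min (m / 3) (r / 2))) :=
      Ioo_mem_nhdsGT (lt_min hδ₀ (lt_min (by positivity) (by positivity)))
    filter_upwards [hCN, hev1, hev2] with δ h1 h2 h3
    have hδ₀' : δ < δ₀ := h3.2.trans_le (min_le_left _ _)
    have hδm : δ < m / 3 := h3.2.trans_le ((min_le_right _ _).trans (min_le_left _ _))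
    have hδr : δ < r / 2 := h3.2.trans_le ((min_le_right _ _).trans (min_le_right _ _))
    have hle := bond_le_one_sub_real_openCrossing R hBfor hU1 hU2 hU3 hU4 hU5 h3.1 hδ₀'
      (by linarith) hδr.le ht₀.le le_rfl
    have hF' := (abs_sub_le_iff.1 hF).2
    linarith
  -- `bond R δ → F(η_R)`, then subtract Smirnov for `R`
  have hb : Tendsto (bondDomainCrossingProb R) (𝓝[>] 0) (𝓝 L) := by
    rw [Metric.tendsto_nhds]
    intro e he
    filter_upwards [hlow e he, hup e he] with δ h1 h2
    rw [Real.dist_eq, abs_sub_lt_iff]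
    constructor <;> linarith
  have key := hb.sub htri
  rw [hL, sub_self] at key
  exact key

/-- **The skeleton theorem: the crux `LoopsToCrossings` BY NAME from the four registered stubs**
(no hypotheses; `sorry` only inside the stubs it invokes). When the stubs are proved this IS the
proof of the crux. [folklore] -/
theorem LoopsToCrossings_of :
    Summit.CriticalPhenomena.CardyFormulaZ2.Theses.CardyMagicRigidity.LoopsToCrossings :=
  -- the C-cores registered so far ride in the cone of the composition (they feed stub C's proof,
  -- `work/C/Plan.lean`: C = transfer_of_pieces S0 (polarZ_of G1) (polarT_of G2 B) (monoTransfer_of …))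
  (fun (_ : _ ∧ _ ∧ _ ∧ _ ∧ _) =>
    tendsto_sub_of_stubs stub_discreteCrossing_of_pathIn stub_not_discreteCrossing_of_dualPathIn
      stub_transfer_tri_to_bond
      stub_comparisonRectangles)
    ⟨stub_zdPlateDuality, stub_plusBlocking, stub_triPlateDuality, stub_transferVerticalTtoZ,
      transferHorizontalZtoT_of_stubs⟩

end Summit.CriticalPhenomena.CardyFormulaZ2.Cruxes.LoopsToCrossings.OracleSandwich

end
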